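import Mathlib
import Summits.BirchSwinnertonDyer.BirchSwinnertonDyer.Theorems.ResidualThetaTransportAtTwoSignedMuSeedAtTwoPlusNonsquareDescentLambda
import HarnessLib

/-!
# Non-square descent — THE CYCLIC LAYER `V_n = k⟦T⟧·ȳ_n` OF DIMENSION `2ⁿ` HAS ANNIHILATOR EXACTLY `(T^{2ⁿ})` (the rank count behind
# precision P3 of the line card `nonsquare-descent`) for the seed crux `SignedMuSeedAtTwoPlus` stmt-BirchSwinnertonDyer-21438
# (parent Kμ⁺ `SignedMuVanishingAtTwoPlus` stmt-BirchSwinnertonDyer-20689, route ResidualThetaTransportAtTwo)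

Cell `bsd-wall`, width seat `bsd-wall-rtt-p4-w2` g17 (`--supports`, closes nothing).  THEOREMS ONLY; BSD is not proved by this; nothing
arithmetic is asserted.

`Cruxes/SignedMuSeedAtTwoPlus/Lines/nonsquare-descent.md` §P3 uses «`V_n = 𝓔_n^χ/2 = 𝔽₄[G_n]·ȳ_n ≅ 𝔽₄[T]/(T^{2ⁿ})`»: the layer is CYCLIC
(generated by `ȳ_n`) of `𝔽₄`-dimension `2ⁿ` (`𝓔_n^χ` is `𝒪`-free of rank `2ⁿ`), hence free of rank one over `𝔽₄[T]/(T^{2ⁿ})`, i.e. the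
annihilator of `ȳ_n` is EXACTLY `(T^{2ⁿ})` — the hypothesis `hann` of `smul_ne_zero_iff_order_lt` («GNS(n) ⟺ λ < 2ⁿ»,
`Theorems/…NonsquareDescentLambda.lean`), there fed by the single bit `T^{2ⁿ−1}·ȳ_n ≠ 0`.  This file derives that bit from the dimension
count.  For a field `k`, a `k⟦X⟧`-module `V` (compatible `k`-structure) and `y ∈ V`:

* §1 `coe_trunc_smul_eq` — if `X^a • y = 0` then `g • y = (trunc_a g) • y` (power series act through their truncations);
  `coe_polynomial_smul_mem_span`, `smul_mem_span_of_X_pow_smul_eq_zero` — every `g • y` lies in the `k`-span of `y, Xy, …, X^{a−1}y`;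
  `span_eq_top_of_generator` — so if `y` generates `V` over `k⟦X⟧`, these `a` vectors span `V` over `k`;
  **`finrank_le_of_X_pow_smul_eq_zero`** — hence `finrank_k V ≤ a`.
* §2 **`X_pow_smul_ne_zero_of_finrank_eq`** — a cyclic layer of `k`-dimension `N ≥ 1` has `X^{N−1} • y ≠ 0`;
  **`smul_eq_zero_iff_of_cyclic_of_finrank_eq`** — with `X^N • y = 0`: `g • y = 0 ↔ X^N ∣ g` (annihilator EXACTLY `(X^N)`), and
  **`smul_ne_zero_iff_order_lt_of_cyclic`** — «GNS(n) ⟺ ord g < N», the P3 criterion with the rank count as its only input.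

Dictionary: `k = 𝔽₄`, `V = 𝓔_n^χ/2`, `y = ȳ_n`, `N = 2ⁿ`, `g = f̄ = f mod 2`.  [folklore]
-/

set_option autoImplicit false
-- the Theorems namespace of this sub repeats the summit name by design (D-0017 nested layout)
set_option linter.dupNamespace false

namespace Summit.BirchSwinnertonDyer.BirchSwinnertonDyer.Theorems.SignedMuAtTwo.NonsquareDescent

section CyclicLayer

variable {k : Type*} [Field k] {V : Type*} [AddCommGroup V] [Module (PowerSeries k) V] [Module k V]
  [IsScalarTower k (PowerSeries k) V]

/-! ## §1 Power series act through truncations on an `X^a`-torsion vector -/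

omit [Module k V] [IsScalarTower k (PowerSeries k) V] in
/-- If `X^a • y = 0` then `g • y = (trunc_a g) • y` for every power series `g`. [folklore] -/
theorem coe_trunc_smul_eq {y : V} {a : ℕ} (hy : (PowerSeries.X : PowerSeries k) ^ a • y = 0) (g : PowerSeries k) :
    ((PowerSeries.trunc a g : Polynomial k) : PowerSeries k) • y = g • y := by
  have hdvd : (PowerSeries.X : PowerSeries k) ^ a ∣ g - ((PowerSeries.trunc a g : Polynomial k) : PowerSeries k) := by
    rw [PowerSeries.X_pow_dvd_iff]
    intro m hm
    rw [map_sub, Polynomial.coeff_coe, PowerSeries.coeff_trunc, if_pos hm, sub_self]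
  obtain ⟨h, hh⟩ := hdvd
  have h0 : (g - ((PowerSeries.trunc a g : Polynomial k) : PowerSeries k)) • y = 0 := by
    rw [hh, mul_comm, mul_smul, hy, smul_zero]
  rw [sub_smul, sub_eq_zero] at h0
  exact h0.symm

/-- If `X^a • y = 0`, every POLYNOMIAL multiple of `y` lies in the `k`-span of `y, X y, …, X^{a−1} y`. [folklore] -/
theorem coe_polynomial_smul_mem_span {y : V} {a : ℕ} (hy : (PowerSeries.X : PowerSeries k) ^ a • y = 0)
    (p : Polynomial k) :
    ((p : PowerSeries k)) • y
      ∈ Submodule.span k (Set.range fun i : Fin a => (PowerSeries.X : PowerSeries k) ^ (i : ℕ) • y) := by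
  induction p using Polynomial.induction_on' with
  | add p q hp hq =>
      rw [Polynomial.coe_add, add_smul]
      exact add_mem hp hq
  | monomial n c =>
      rw [← Polynomial.C_mul_X_pow_eq_monomial, Polynomial.coe_mul, Polynomial.coe_pow, Polynomial.coe_C,
        Polynomial.coe_X, mul_smul, PowerSeries.C_eq_algebraMap, algebraMap_smul]
      refine Submodule.smul_mem _ c ?_
      by_cases hn : n < a
      · exact Submodule.subset_span ⟨⟨n, hn⟩, rfl⟩
      · have h0 : (PowerSeries.X : PowerSeries k) ^ n • y = 0 := by
          rw [show n = (n - a) + a by omega, pow_add, mul_smul, hy, smul_zero]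
        rw [h0]
        exact zero_mem _

/-- If `X^a • y = 0`, every power-series multiple of `y` lies in the `k`-span of `y, X y, …, X^{a−1} y`. [folklore] -/
theorem smul_mem_span_of_X_pow_smul_eq_zero {y : V} {a : ℕ} (hy : (PowerSeries.X : PowerSeries k) ^ a • y = 0)
    (g : PowerSeries k) :
    g • y ∈ Submodule.span k (Set.range fun i : Fin a => (PowerSeries.X : PowerSeries k) ^ (i : ℕ) • y) := by
  rw [← coe_trunc_smul_eq hy g]
  exact coe_polynomial_smul_mem_span hy _

/-- **A cyclic `X^a`-torsion layer is `k`-spanned by `y, Xy, …, X^{a−1}y`.** [folklore] -/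
theorem span_eq_top_of_generator {y : V} (hgen : ∀ v : V, ∃ g : PowerSeries k, g • y = v) {a : ℕ}
    (hy : (PowerSeries.X : PowerSeries k) ^ a • y = 0) :
    Submodule.span k (Set.range fun i : Fin a => (PowerSeries.X : PowerSeries k) ^ (i : ℕ) • y) = ⊤ := by
  rw [eq_top_iff]
  intro v _
  obtain ⟨g, rfl⟩ := hgen v
  exact smul_mem_span_of_X_pow_smul_eq_zero hy g

/-- **Hence `finrank_k V ≤ a`** for a cyclic layer killed by `X^a`. [folklore] -/
theorem finrank_le_of_X_pow_smul_eq_zero {y : V} (hgen : ∀ v : V, ∃ g : PowerSeries k, g • y = v) {a : ℕ}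
    (hy : (PowerSeries.X : PowerSeries k) ^ a • y = 0) : Module.finrank k V ≤ a := by
  have h := span_eq_top_of_generator hgen hy
  have hle := finrank_range_le_card (R := k) (fun i : Fin a => (PowerSeries.X : PowerSeries k) ^ (i : ℕ) • y)
  rw [Set.finrank, h, finrank_top, Fintype.card_fin] at hle
  exact hle

/-! ## §2 The rank count gives the bit `X^{N−1} • y ≠ 0`, hence the exact annihilator -/

/-- **A cyclic layer of `k`-dimension `N ≥ 1` has `X^{N−1} • y ≠ 0`** (else it would be spanned by `N − 1` vectors). [folklore] -/
theorem X_pow_smul_ne_zero_of_finrank_eq {y : V} (hgen : ∀ v : V, ∃ g : PowerSeries k, g • y = v) {N : ℕ}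
    (hN : Module.finrank k V = N) (hpos : 0 < N) :
    (PowerSeries.X : PowerSeries k) ^ (N - 1) • y ≠ 0 := by
  intro h
  have hle := finrank_le_of_X_pow_smul_eq_zero hgen h
  omega

/-- **The annihilator of the generator of a cyclic layer of dimension `N` killed by `X^N` is EXACTLY `(X^N)`** — the hypothesis `hann`
of `smul_ne_zero_iff_order_lt` (P3), from the rank count alone. [folklore] -/
theorem smul_eq_zero_iff_of_cyclic_of_finrank_eq {y : V} (hgen : ∀ v : V, ∃ g : PowerSeries k, g • y = v) {N : ℕ}
    (hN : Module.finrank k V = N) (hpos : 0 < N) (hy0 : (PowerSeries.X : PowerSeries k) ^ N • y = 0)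
    (g : PowerSeries k) : g • y = 0 ↔ (PowerSeries.X : PowerSeries k) ^ N ∣ g :=
  smul_eq_zero_iff_X_pow_dvd hy0 (X_pow_smul_ne_zero_of_finrank_eq hgen hN hpos) g

/-- **«GNS(n) ⟺ λ < 2ⁿ» with the rank count as its only structural input**: for the generator `y` of a cyclic `k⟦X⟧`-layer of `k`-dimension
`N ≥ 1` killed by `X^N`, and any `g` (`f̄ = f mod 2`): `g • y ≠ 0 ↔ ord g < N`. [folklore] -/
theorem smul_ne_zero_iff_order_lt_of_cyclic {y : V} (hgen : ∀ v : V, ∃ g : PowerSeries k, g • y = v) {N : ℕ}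
    (hN : Module.finrank k V = N) (hpos : 0 < N) (hy0 : (PowerSeries.X : PowerSeries k) ^ N • y = 0)
    (g : PowerSeries k) : g • y ≠ 0 ↔ g.order < (N : ℕ∞) :=
  smul_ne_zero_iff_order_lt (smul_eq_zero_iff_of_cyclic_of_finrank_eq hgen hN hpos hy0) g

end CyclicLayer

end Summit.BirchSwinnertonDyer.BirchSwinnertonDyer.Theorems.SignedMuAtTwo.NonsquareDescent
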